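import Mathlib.GroupTheory.PGroup
import Mathlib.Algebra.Module.ZMod
import Mathlib.Algebra.Field.ZMod
import Mathlib.FieldTheory.Finiteness
import Mathlib.Algebra.CharP.Lemmas
import Mathlib.RingTheory.Finiteness.Cardinality
import Literature.NumberTheory.Automorphic.SmoothRepresentation
import Literature.NumberTheory.Automorphic.SmoothRepresentationProofs
import HarnessLib

/-!
# Fixed vectors of pro-`p` groups in smooth representations over fields of characteristic `p`

Topic `NumberTheory/Automorphic`, namespace `Literature.NumberTheory.Automorphic`.  The basic
tool of the mod `p` representation theory of `p`-adic groups (Barthel–Livné, Breuil, Paškūnas,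
Breuil–Paškūnas): **a non-zero smooth representation of a pro-`p` group on a vector space over
a field of characteristic `p` has a non-zero fixed vector** — so that, for `G = GL₂(F)` and the
pro-`p` Iwahori subgroup `I₁`, every non-zero subrepresentation of a smooth `π` meets `π^{I₁}`
(Breuil–Paškūnas 2012, §1 p. 5: "`I₁ ⊂ I` its maximal pro-`p` subgroup", and §7 p. 45: "Since
`Z₁` is pro-`p` and `χ` is smooth, we have `χ(Z₁) = 1`"; the `I(1)`-invariants of Barthel–Livné
1994; the underlying finite-group statement is Serre, *Linear representations of finite groups*,
§8.3 Prop. 26: the only irreducible representation of a `p`-group in characteristic `p` is the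
trivial one, i.e. a `p`-group acting linearly on a non-zero vector space over a field of
characteristic `p` fixes a non-zero vector).

"Pro-`p`" is taken in the elementwise topological form `h^{p^m} → 1` (`m → ∞`) for the elements
`h` of a subgroup `H ≤ G` whose carrier is compact (`IsCompact (H : Set G)`) — the form in which
it is verified for matrix groups (the pro-`p` Iwahori subgroup of `GL₂(F)`, sibling file
`ProPIwahoriGL2`) and already used in the tree for wild inertia (`ArtinConductorWildProofs`).
Theorems only; no definitions, no named facts.

## Main statements (all proved)

* `exists_ne_zero_fixed_of_tendsto_pow_prime_pow`: `ρ` a smooth representation of a topological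
  group `G` over a field `k` with `CharP k p`, `H ≤ G` with compact carrier and `h^{p^m} → 1` for
  `h ∈ H`, `v ≠ 0`: the `k`-span of the orbit `ρ(H) v` contains a non-zero `H`-fixed vector.
  Proof (the printed one): the orbit `S = ρ(H) v` is finite (smoothness + compactness); its
  `𝔽_p`-span `X` is a finite set of cardinality `p^d`, `d ≥ 1`, stable under `H`; the image `Q`
  of `H` in `Perm X` is a `p`-group because the pointwise stabiliser of `S` is open and
  `h^{p^m} → 1`; `|X^Q| ≡ |X| ≡ 0 mod p` and `0 ∈ X^Q` give a second fixed point
  (`IsPGroup.exists_fixed_point_of_prime_dvd_card_of_fixed_point`).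
* `inf_fixedPoints_ne_bot_of_tendsto_pow_prime_pow`, `fixedPoints_ne_bot_of_tendsto_pow_prime_pow`:
  the usual corollaries (`W ∩ V^H ≠ 0` for a non-zero `H`-stable subspace `W`; `V^H ≠ 0`).
* `apply_eq_self_of_tendsto_pow_prime_pow`, `eq_one_of_isOpen_ker_of_tendsto_pow_prime_pow`:
  **smooth characters of pro-`p` groups with values in a field of characteristic `p` are
  trivial** (`c^{p^m} = 1` forces `(c - 1)^{p^m} = 0`).

## References

* C. Breuil, V. Paškūnas, *Towards a modulo `p` Langlands correspondence for `GL₂`*, Mem. AMS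
  216 (2012), §1 pp. 5, 12 (`I₁`, `K_m`), §7 p. 45 (pages of the authors' version).
  [cite: BreuilPaskunas2012, §1]
* L. Barthel, R. Livné, *Irreducible modular representations of `GL₂` of a local field*, Duke
  Math. J. 75 (1994) (the `I(1)`-invariants of smooth mod `p` representations).
* J.-P. Serre, *Linear representations of finite groups*, GTM 42, §8.3 Prop. 26 (the finite
  `p`-group lemma).
-/

open Filter Topology

namespace Literature.NumberTheory.Automorphic

universe u v w

section FixedVectors

variable {k : Type u} [Field k] {p : ℕ} [Fact p.Prime] [CharP k p]
variable {G : Type v} [Group G] [TopologicalSpace G] [SeparatelyContinuousMul G]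
variable {V : Type w} [AddCommGroup V] [Module k V]

/-- **A pro-`p` group fixes a non-zero vector in every non-zero smooth mod `p` representation
(orbit form).**  Let `ρ` be a smooth representation of `G` on a `k`-vector space, `char k = p`,
and `H ≤ G` a subgroup with compact carrier whose elements satisfy `h^{p^m} → 1`.  For every
`v ≠ 0` the `k`-span of the orbit `ρ(H) v` contains a non-zero vector fixed by `H`.
(Serre, *Linear representations of finite groups*, §8.3 Prop. 26, for the finite `p`-group
through which `H` acts on the `𝔽_p`-span of the orbit; Breuil–Paškūnas 2012, §1 p. 5, §7 p. 45.)
[folklore] -/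
theorem exists_ne_zero_fixed_of_tendsto_pow_prime_pow (ρ : Representation k G V)
    (hρ : ρ.IsSmooth) (H : Subgroup G) (hH : IsCompact (H : Set G))
    (hp : ∀ h ∈ H, Tendsto (fun m : ℕ => h ^ p ^ m) atTop (𝓝 1)) {v : V} (hv : v ≠ 0) :
    ∃ w ∈ Submodule.span k ((fun h : G => ρ h v) '' (H : Set G)),
      w ≠ 0 ∧ ∀ h ∈ H, ρ h w = w := by
  classical
  set S : Set V := (fun h : G => ρ h v) '' (H : Set G) with hS_def
  have hSfin : S.Finite := hρ.finite_image_apply hH v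
  have hvS : v ∈ S := ⟨1, H.one_mem, by simp⟩
  have hS_stab : ∀ h ∈ H, ∀ s ∈ S, ρ h s ∈ S := by
    rintro h hh _ ⟨h', hh', rfl⟩
    exact ⟨h * h', H.mul_mem hh hh', by simp [map_mul]⟩
  -- `V` as an `𝔽_p`-vector space, `X` the `𝔽_p`-span of the orbit: a finite `H`-stable set
  letI : Module (ZMod p) V := Module.compHom V (ZMod.castHom (dvd_refl p) k)
  haveI : Module.Finite (ZMod p) ↥(Submodule.span (ZMod p) S) :=
    Module.Finite.span_of_finite (ZMod p) hSfin
  haveI : Finite ↥(Submodule.span (ZMod p) S) := Module.finite_of_finite (ZMod p)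
  have hX_stab : ∀ h ∈ H, ∀ x ∈ Submodule.span (ZMod p) S,
      ρ h x ∈ Submodule.span (ZMod p) S := by
    intro h hh x hx
    induction hx using Submodule.span_induction with
    | mem s hs => exact Submodule.subset_span (hS_stab h hh s hs)
    | zero => simp
    | add x y _ _ hx hy => simpa only [map_add] using Submodule.add_mem _ hx hy
    | smul c x _ hx =>
        rw [ZMod.map_smul (ρ h) c x]
        exact Submodule.smul_mem _ c hx
  -- an element of `H` fixing `S` pointwise fixes `X` pointwise
  have hfix : ∀ g ∈ H, (∀ s ∈ S, ρ g s = s) → ∀ x ∈ Submodule.span (ZMod p) S, ρ g x = x := by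
    intro g _ hg x hx
    induction hx using Submodule.span_induction with
    | mem s hs => exact hg s hs
    | zero => simp
    | add x y _ _ hx hy => rw [map_add, hx, hy]
    | smul c x _ hx => rw [ZMod.map_smul (ρ g) c x, hx]
  -- the permutation action of `H` on `X`, the `𝔽_p`-span of the orbit
  let e : H → Equiv.Perm ↥(Submodule.span (ZMod p) S) := fun h =>
    { toFun := fun x => ⟨ρ (h : G) x, hX_stab h h.2 x x.2⟩
      invFun := fun x => ⟨ρ ((h : G)⁻¹) x, hX_stab _ (H.inv_mem h.2) x x.2⟩
      left_inv := fun x => Subtype.ext (by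
        simp only
        rw [← Module.End.mul_apply, ← map_mul, inv_mul_cancel, map_one, Module.End.one_apply])
      right_inv := fun x => Subtype.ext (by
        simp only
        rw [← Module.End.mul_apply, ← map_mul, mul_inv_cancel, map_one, Module.End.one_apply]) }
  have e_apply : ∀ (h : H) (x : ↥(Submodule.span (ZMod p) S)),
      ((e h x : ↥(Submodule.span (ZMod p) S)) : V) = ρ (h : G) x := fun h x => rfl
  let φ : H →* Equiv.Perm ↥(Submodule.span (ZMod p) S) :=
    { toFun := e
      map_one' := by
        ext x
        rw [e_apply]
        simp
      map_mul' := fun a b => by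
        ext x
        simp only [Equiv.Perm.coe_mul, Function.comp_apply, e_apply, Subgroup.coe_mul, map_mul,
          Module.End.mul_apply] }
  have φ_apply : ∀ (h : H) (x : ↥(Submodule.span (ZMod p) S)),
      ((φ h x : ↥(Submodule.span (ZMod p) S)) : V) = ρ (h : G) x := fun h x => rfl
  set Q : Subgroup (Equiv.Perm ↥(Submodule.span (ZMod p) S)) := φ.range with hQ_def
  -- `Q` is a `p`-group: the pointwise stabiliser of `S` is open and `h ^ p ^ m → 1`
  have hQ : IsPGroup p Q := by
    intro q
    obtain ⟨h, hh⟩ := MonoidHom.mem_range.1 q.2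
    have hN : (⋂ s ∈ hSfin.toFinset, (ρ.stabilizerSubgroup s : Set G)) ∈ 𝓝 (1 : G) := by
      refine (isOpen_biInter_finset fun s _ => hρ s).mem_nhds ?_
      simp only [Set.mem_iInter, SetLike.mem_coe, Representation.mem_stabilizerSubgroup, map_one,
        Module.End.one_apply, implies_true]
    obtain ⟨m, hm⟩ := ((hp h h.2).eventually_mem hN).exists
    refine ⟨m, Subtype.ext ?_⟩
    rw [Subgroup.coe_pow, Subgroup.coe_one, ← hh, ← map_pow]
    ext x
    rw [φ_apply, Equiv.Perm.coe_one, id_eq, Subgroup.coe_pow]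
    refine hfix _ (H.pow_mem h.2 _) (fun s hs => ?_) x x.2
    simp only [Set.mem_iInter, SetLike.mem_coe, Representation.mem_stabilizerSubgroup,
      Set.Finite.mem_toFinset] at hm
    exact hm s hs
  -- `|X| = p ^ d` with `d ≥ 1`
  have hcard : p ∣ Nat.card ↥(Submodule.span (ZMod p) S) := by
    haveI : Nontrivial ↥(Submodule.span (ZMod p) S) :=
      ⟨⟨⟨v, Submodule.subset_span hvS⟩, 0, fun h0 => hv (congrArg Subtype.val h0)⟩⟩
    rw [Module.natCard_eq_pow_finrank (K := ZMod p) (V := ↥(Submodule.span (ZMod p) S)),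
      Nat.card_zmod]
    exact dvd_pow_self p (Module.finrank_pos (R := ZMod p) (M := ↥(Submodule.span (ZMod p) S))).ne'
  have h0 : (0 : ↥(Submodule.span (ZMod p) S)) ∈
      MulAction.fixedPoints Q ↥(Submodule.span (ZMod p) S) := by
    rintro ⟨_, h, rfl⟩
    refine Subtype.ext ?_
    change ((φ h (0 : ↥(Submodule.span (ZMod p) S)) : ↥(Submodule.span (ZMod p) S)) : V) = 0
    rw [φ_apply, ZeroMemClass.coe_zero, map_zero]
  obtain ⟨b, hb, hb0⟩ :=
    hQ.exists_fixed_point_of_prime_dvd_card_of_fixed_point (↥(Submodule.span (ZMod p) S)) hcard h0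
  refine ⟨(b : V), ?_, fun hb' => hb0 (Subtype.ext hb'.symm), fun h hh => ?_⟩
  · -- `X ⊆ span_k S`
    have hXle : ∀ x ∈ Submodule.span (ZMod p) S, x ∈ Submodule.span k S := by
      intro x hx
      induction hx using Submodule.span_induction with
      | mem s hs => exact Submodule.subset_span hs
      | zero => exact zero_mem _
      | add x y _ _ hx hy => exact add_mem hx hy
      | smul c x _ hx => exact ZMod.smul_mem hx c
    exact hXle b b.2
  · have := hb ⟨φ ⟨h, hh⟩, ⟨h, hh⟩, rfl⟩
    exact congrArg (fun x : ↥(Submodule.span (ZMod p) S) => (x : V)) this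

/-- **Corollary (stable subspaces).**  Under the hypotheses of
`exists_ne_zero_fixed_of_tendsto_pow_prime_pow`, every non-zero `H`-stable `k`-subspace `W`
meets the `H`-fixed vectors non-trivially: `W ∩ V^H ≠ 0` (for `GL₂(F)` and `H = I₁`: every
non-zero subrepresentation of a smooth mod `p` representation has non-zero `I₁`-invariants).
[folklore] -/
theorem inf_fixedPoints_ne_bot_of_tendsto_pow_prime_pow (ρ : Representation k G V)
    (hρ : ρ.IsSmooth) (H : Subgroup G) (hH : IsCompact (H : Set G))
    (hp : ∀ h ∈ H, Tendsto (fun m : ℕ => h ^ p ^ m) atTop (𝓝 1)) (W : Submodule k V)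
    (hW : ∀ h ∈ H, ∀ w ∈ W, ρ h w ∈ W) (hW0 : W ≠ ⊥) : W ⊓ ρ.fixedPoints H ≠ ⊥ := by
  obtain ⟨v, hvW, hv⟩ := Submodule.exists_mem_ne_zero_of_ne_bot hW0
  obtain ⟨w, hw, hw0, hwfix⟩ := exists_ne_zero_fixed_of_tendsto_pow_prime_pow ρ hρ H hH hp hv
  have hwW : w ∈ W := by
    refine (Submodule.span_le.2 ?_) hw
    rintro _ ⟨h, hh, rfl⟩
    exact hW h hh v hvW
  intro hbot
  have : w ∈ W ⊓ ρ.fixedPoints H :=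
    Submodule.mem_inf.2 ⟨hwW, (ρ.mem_fixedPoints H w).2 hwfix⟩
  rw [hbot, Submodule.mem_bot] at this
  exact hw0 this

/-- **Corollary.**  A non-zero smooth representation over a field of characteristic `p` has a
non-zero vector fixed by any subgroup `H` with compact carrier and `h^{p^m} → 1` on `H`
(`V^H ≠ 0`). [folklore] -/
theorem fixedPoints_ne_bot_of_tendsto_pow_prime_pow [Nontrivial V] (ρ : Representation k G V)
    (hρ : ρ.IsSmooth) (H : Subgroup G) (hH : IsCompact (H : Set G))
    (hp : ∀ h ∈ H, Tendsto (fun m : ℕ => h ^ p ^ m) atTop (𝓝 1)) : ρ.fixedPoints H ≠ ⊥ := by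
  have h := inf_fixedPoints_ne_bot_of_tendsto_pow_prime_pow ρ hρ H hH hp ⊤
    (fun _ _ _ _ => Submodule.mem_top) top_ne_bot
  rwa [top_inf_eq] at h

end FixedVectors

/-! ### Smooth characters of pro-`p` groups are trivial in characteristic `p` -/

section Characters

variable {k : Type u} [Field k] {p : ℕ} [Fact p.Prime] [CharP k p]
variable {G : Type v} [Group G] [TopologicalSpace G]

/-- In a field of characteristic `p`, `c ^ p ^ m = 1` forces `c = 1`
(`(c - 1)^{p^m} = c^{p^m} - 1 = 0`). [folklore] -/
theorem eq_one_of_pow_prime_pow_eq_one {c : k} {m : ℕ} (h : c ^ p ^ m = 1) : c = 1 := by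
  have h1 : (c - 1) ^ p ^ m = 0 := by
    rw [sub_pow_char_pow, h, one_pow, sub_self]
  exact sub_eq_zero.1 (pow_eq_zero_iff (pow_ne_zero m (Fact.out : p.Prime).ne_zero) |>.1 h1)

/-- **Smooth `k`-valued characters of a pro-`p` group are trivial, `char k = p`** (form for a
one-dimensional representation `χ : G → GL₁(k)`): if the stabiliser of `1 ∈ k` is open and
`g^{p^m} → 1`, then `χ(g) = 1`.  Indeed `c = χ(g) 1` satisfies `c^{p^m} = 1` for `m ≫ 0`, and
`(c - 1)^{p^m} = c^{p^m} - 1`.  (Breuil–Paškūnas 2012, §7 p. 45: "Since `Z₁` is pro-`p` and `χ` is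
smooth, we have `χ(Z₁) = 1`"; used likewise for the characters of `B ∩ I₁` when computing the
`I₁`-invariants of principal series.) [folklore] -/
theorem apply_eq_self_of_tendsto_pow_prime_pow (χ : Representation k G k)
    (hχ : χ.IsSmoothVector 1) {g : G} (hg : Tendsto (fun m : ℕ => g ^ p ^ m) atTop (𝓝 1))
    (x : k) : χ g x = x := by
  set c : k := χ g 1 with hc
  have hlin : ∀ (h : G) (y : k), χ h y = y * χ h 1 := fun h y => by
    conv_lhs => rw [← mul_one y, ← smul_eq_mul, map_smul, smul_eq_mul]
  have hpow : ∀ n : ℕ, χ (g ^ n) 1 = c ^ n := by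
    intro n
    induction n with
    | zero => simp
    | succ n ih =>
        rw [pow_succ, map_mul, Module.End.mul_apply, hlin (g ^ n) (χ g 1), ih, ← hc, pow_succ,
          mul_comm]
  have hN : ((χ.stabilizerSubgroup 1 : Subgroup G) : Set G) ∈ 𝓝 (1 : G) :=
    hχ.mem_nhds (by simp)
  obtain ⟨m, hm⟩ := (hg.eventually_mem hN).exists
  have hcm : c ^ p ^ m = 1 := by
    rw [← hpow]
    exact hm
  have hc1 : c = 1 := eq_one_of_pow_prime_pow_eq_one hcm
  calc χ g x = χ g (x • (1 : k)) := by rw [smul_eq_mul, mul_one]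
    _ = x • c := by rw [map_smul]
    _ = x := by rw [hc1, smul_eq_mul, mul_one]

/-- **Smooth `kˣ`-valued characters of a pro-`p` group are trivial, `char k = p`** (form for a
homomorphism `χ : G →* kˣ` with open kernel): if `g^{p^m} → 1` then `χ g = 1`. [folklore] -/
theorem eq_one_of_isOpen_ker_of_tendsto_pow_prime_pow (χ : G →* kˣ)
    (hχ : IsOpen (χ.ker : Set G)) {g : G} (hg : Tendsto (fun m : ℕ => g ^ p ^ m) atTop (𝓝 1)) :
    χ g = 1 := by
  have hN : ((χ.ker : Subgroup G) : Set G) ∈ 𝓝 (1 : G) := hχ.mem_nhds (by simp)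
  obtain ⟨m, hm⟩ := (hg.eventually_mem hN).exists
  have hcm : ((χ g : kˣ) : k) ^ p ^ m = 1 := by
    rw [← Units.val_pow_eq_pow_val, ← map_pow, (MonoidHom.mem_ker).1 hm, Units.val_one]
  exact Units.ext (eq_one_of_pow_prime_pow_eq_one hcm)

end Characters

end Literature.NumberTheory.Automorphic
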